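import Summits.QuantumFields.BalabanUV.Beta.RemainderExplicitTorusColumn
import Literature.MathematicalPhysics.QuantumFieldTheory.Balaban1983to89.B5DPD126Uniform

/-!
# Beta / RemainderExplicitTorusBounds — BINDER-OWNERS row D4, ROAD P3 (co-owner #3, unit `b2b-balaban-beta-d4-p3`), skeleton leaves
# V2/E3.4 (second half of the torus step): THE BAŁABAN-NORMALISED PERIODISED TEST CONFIGURATION `hTor = N^5·ℋ^per` ON THE TORUS OF
# UNIT SIDE `P` AND ITS FOUR (3.14)/(4.4)-TYPE COMPONENTS — `|h|`, `N·|∇h|`, `N²·|Δ_vec h|`, `N²·|d d* h|` — BOUNDED BY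
# `C₁·e^{−κ₁·tdist_P(block of z, source block)}` WITH ONE `(κ₁, C₁)` FOR EVERY LEVEL `N = Lc^{j+1}` AND EVERY VOLUME `P ≥ 1`

HONEST FRAMING (page 1 of everything the β sub-cell writes): discharging `BetaPertH` makes Bałaban's UV stability
UNCONDITIONAL — a real constructive-QFT result; it is NOT the continuum limit and NOT the Clay problem.  HONEST DEPENDENCY
(verbatim): «continuum YM on T⁴ ⇐ BetaPertH ∧ nine spine estimates (0/9 proved); BetaPertH ⇐ (D1) ∧ (D4) ∧ CAP+tail;
G-an2-4 gates asym, D1 and NE2/3/4.»  NOT IN PRINT; OUR BOOKKEEPING.  `[folklore]`: road P3's level-uniform four-component bound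
`RemainderExplicitSecondOrder.exists_norm314_bounds` pushed through the block-scale periodisation bound of the companion file
`RemainderExplicitTorusColumn.periodise_block_decay` (pv17's `B4TorusKernel` engine), term by term along gan24-leaf-18's absolutely
convergent period sums (`GAN24.TorusPeriodise.Hper`).  No cited fact, no wall binder, no `def … : Prop`; nothing about Bałaban's densities
is asserted.  NOT summit progress.

ABSOLUTE RULE (cell charter, verbatim): "No internally-minted statement may enter as a cited fact. Every hypothesis is
either kernel-proved in this package or a verbatim quotation of a PUBLISHED theorem with page reference. The manuscript(s)
under audit are NOT citable for their own disputed steps — they are the thing under adjudication; programme-internal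
(2001/route/tribunal) claims are never citable."

## Why road P3 wants this (skeleton `HOME/beta/skeletons/D4-b2b-balaban-beta-d4-p3.md` §3 leaves E1/E3.4)

This is the torus form of [Balaban1987RG1] p. 282's «can be estimated by B₃∏|B_i| … the additional exponential factor
exp(−δ₀dist^{(ξ)}(X, supp B_i))» for the EXPLICIT test configurations of road P3: on every torus of the remainder chain's exhausting
family the four (3.14)/(4.4)-type components of the periodised, Bałaban-normalised column with source block `q` are bounded at the fine
point `z` by `C₁·e^{−κ₁·(sup-distance on the unit torus between the block of z and q)}`, `(κ₁, C₁)` free of the level and of the volume —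
exactly what the carrier's `ExplicitCarrier.Decay B₃ δ₀` (`RemainderExplicitRoad`) needs once the restriction to a localization domain
and the comparison of the torus sup-distance with the chain's `distCT` are supplied (companion leaf E1).
-/

noncomputable section

open Finset Filter
open scoped BigOperators
open Literature.Probability.LatticeModels (TorusSite Torus.proj)
open Literature.MathematicalPhysics.QuantumFieldTheory.LatticeForm (quo repZ)
open Literature.MathematicalPhysics.QuantumFieldTheory.Balaban1983to89
open Literature.MathematicalPhysics.QuantumFieldTheory.Balaban1983to89.Beta
open AffineAveraging (Site Form0 Form1 unitVec curv curvAdj dz codiff₁)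
open B4ContourShift (supNorm supNorm_nonneg)
open B4TorusKernel (periodConst)
open B5DPD126Uniform (periodConst_nonneg_of_pos)
open B4TorusKernel.MultiPeriod (torusSupNorm torusSupNorm_nonneg)
open BlochFibreUniqueness (quo_add_zsmul)
open KernelSpecInstance (wH hasSum_dz hasSum_codiff₁)
open ResolventComposition (Hcol)
open Summit.QuantumFields.BalabanUV.Beta.GAN24.TorusPeriodise (pshift Hper hasSum_Hper)
open Summit.QuantumFields.BalabanUV.Beta.RemainderExplicitUnits (side side_pos hBal)
open Summit.QuantumFields.BalabanUV.Beta.RemainderExplicitSecondOrder (lapVec lapVec_smul dz_codiff₁_smul exists_norm314_bounds)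
open Summit.QuantumFields.BalabanUV.Beta.RemainderExplicitTorusColumn (periodise_block_decay hasSum_Hper_wH hasSum_lapVec
  lapVec_translate dz_codiff₁_translate sub_zsmul_sub_pshift)

namespace Summit.QuantumFields.BalabanUV.Beta.RemainderExplicitTorusBounds

variable {Lc : ℕ} [NeZero Lc]

/-! ## §1 The Bałaban-normalised periodised test configuration on the torus -/

/-- **THE PERIODISED, BAŁABAN-NORMALISED TEST CONFIGURATION** at level `j` (block side `N = Lc^{j+1} = ξ⁻¹`) on the fine torus over the
unit torus with `P_ν` sites per direction, for the source bond `(μ, q)` (`q ∈ ℤ⁴` any lift of the unit-torus source site):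
`hTor j P μ q κ z := N^5 · ℋ^per_{(μ,q)}(κ, z) = N^5 · Σ_{t ∈ ℤ⁴} wH^{(N)} κ μ (z − N•q + N•pshift P t)` (gan24-leaf-18's `Hper`). [folklore] -/
def hTor (Lc : ℕ) [NeZero Lc] (j : ℕ) (P : Fin 4 → ℕ) [∀ ν, NeZero (P ν)] (μ : Fin 4) (q : Site 4) : Form1 4 ℝ :=
  haveI : NeZero (Lc ^ (j + 1)) := ⟨pow_ne_zero _ (NeZero.ne Lc)⟩
  fun κ z => side Lc j ^ 5 * Hper (Lc ^ (j + 1)) P μ q κ z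

/-! ## §2 The four components, uniformly in the level and the volume -/

/-- [folklore] **THE FOUR (3.14)/(4.4)-TYPE COMPONENTS OF `hTor` DECAY IN THE UNIT-TORUS BLOCK DISTANCE, UNIFORMLY IN LEVEL AND VOLUME**
(d + 1 = 4): ONE rate `κ₁ > 0` and ONE constant `C₁` such that for every level `j`, every period vector `P` (all `P_ν ≥ 1`), every
source bond `(μ, q)`, component `κ`, direction `ν` and fine point `z`, with `τ := torusSupNorm P (quo_{N_j} z − q)` (the sup-distance on
the unit torus `Π_ν ℤ/P_ν` between the block of `z` and the source block) and `N_j = side Lc j = Lc^{j+1}`: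
`|hTor κ z| ≤ C₁e^{−κ₁τ}`, `N_j·|hTor κ (z+e_ν) − hTor κ z| ≤ C₁e^{−κ₁τ}`, `N_j²·|Δ_vec hTor ν z| ≤ C₁e^{−κ₁τ}`,
`N_j²·|dz (codiff₁ hTor) ν z| ≤ C₁e^{−κ₁τ}`. -/
theorem exists_hTor_bounds :
    ∃ κ₁ C₁ : ℝ, 0 < κ₁ ∧ 0 ≤ C₁ ∧ ∀ (j : ℕ) (P : Fin 4 → ℕ) [∀ ν, NeZero (P ν)] (μ : Fin 4) (q : Site 4) (κ ν : Fin 4) (z : Site 4),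
      (|hTor Lc j P μ q κ z|
          ≤ C₁ * Real.exp (-(κ₁ * torusSupNorm P (quo (Lc ^ (j + 1)) z - q)))) ∧
      (side Lc j * |hTor Lc j P μ q κ (z + unitVec ν) - hTor Lc j P μ q κ z|
          ≤ C₁ * Real.exp (-(κ₁ * torusSupNorm P (quo (Lc ^ (j + 1)) z - q)))) ∧
      (side Lc j ^ 2 * |lapVec (hTor Lc j P μ q) ν z|
          ≤ C₁ * Real.exp (-(κ₁ * torusSupNorm P (quo (Lc ^ (j + 1)) z - q)))) ∧
      (side Lc j ^ 2 * |dz (codiff₁ (hTor Lc j P μ q)) ν z|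
          ≤ C₁ * Real.exp (-(κ₁ * torusSupNorm P (quo (Lc ^ (j + 1)) z - q)))) := by
  obtain ⟨κ₀, C, hκ₀, hC, h1, h2, h3, h4⟩ := exists_norm314_bounds (Lc := Lc)
  refine ⟨κ₀ / ((3 : ℕ) + 1), C * periodConst κ₀ 3, by positivity, mul_nonneg hC (periodConst_nonneg_of_pos hκ₀ 3), ?_⟩
  intro j P _ μ q κ ν z
  haveI hNz : NeZero (Lc ^ (j + 1)) := ⟨pow_ne_zero _ (NeZero.ne Lc)⟩
  set N : ℕ := Lc ^ (j + 1) with hN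
  -- `hTor` read through the ambient instance (proof-irrelevant `NeZero`)
  have hT : ∀ (κ' : Fin 4) (w : Site 4), hTor Lc j P μ q κ' w = side Lc j ^ 5 * Hper N P μ q κ' w := fun _ _ => rfl
  have hTf : hTor Lc j P μ q = fun κ' w => side Lc j ^ 5 * Hper N P μ q κ' w := rfl
  have hP : ∀ i, 1 ≤ P i := fun i => Nat.one_le_iff_ne_zero.2 (NeZero.ne (P i))
  have hs : 0 < side Lc j := side_pos j
  -- the re-based fine point and its block
  set z' : Site 4 := z - (N : ℤ) • q with hz'
  have hq : quo N z' = quo N z - q := by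
    rw [hz', show z - (N : ℤ) • q = z + (N : ℤ) • (-q) by rw [smul_neg, sub_eq_add_neg], quo_add_zsmul]
    abel
  -- the column as a lambda (for the scaling/translation lemmas)
  have ecol : (fun κ w => hBal Lc j κ μ w) = fun κ w => side Lc j ^ 5 * wH (N := N) κ μ w := by funext κ w; rfl
  refine ⟨?_, ?_, ?_, ?_⟩
  · -- |h|
    have hg : ∀ w, |side Lc j ^ 5 * wH (N := N) κ μ w| ≤ C * Real.exp (-(κ₀ * supNorm (quo N w))) := fun w => h1 j κ μ w
    obtain ⟨_, hb⟩ := periodise_block_decay (N := N) (fun w => side Lc j ^ 5 * wH (N := N) κ μ w) hκ₀ hg hP z'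
    have e : hTor Lc j P μ q κ z = ∑' t : Site 4, side Lc j ^ 5 * wH (N := N) κ μ (z' + (N : ℤ) • pshift P t) := by
      rw [hT]; exact (((hasSum_Hper_wH (N := N) P μ q κ z).mul_left (side Lc j ^ 5)).tsum_eq).symm
    rw [e, ← hq]
    exact hb
  · -- N·|∇h|
    set g : Site 4 → ℝ := fun w => side Lc j * (side Lc j ^ 5 * wH (N := N) κ μ (w + unitVec ν) - side Lc j ^ 5 * wH (N := N) κ μ w)
      with hgdef
    have hg : ∀ w, |g w| ≤ C * Real.exp (-(κ₀ * supNorm (quo N w))) := fun w => by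
      have := h2 j κ μ ν w
      rw [hgdef, abs_mul, abs_of_pos hs]
      exact this
    obtain ⟨_, hb⟩ := periodise_block_decay (N := N) g hκ₀ hg hP z'
    have H1 := hasSum_Hper_wH (N := N) P μ q κ (z + unitVec ν)
    have H0 := hasSum_Hper_wH (N := N) P μ q κ z
    have H := (H1.sub H0).mul_left (side Lc j * side Lc j ^ 5)
    have efun : (fun t : Site 4 => side Lc j * side Lc j ^ 5 *
        (wH (N := N) κ μ (z + unitVec ν - (N : ℤ) • q + (N : ℤ) • pshift P t) - wH (N := N) κ μ (z - (N : ℤ) • q + (N : ℤ) • pshift P t)))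
        = fun t => g (z' + (N : ℤ) • pshift P t) := by
      funext t
      have ept : z + unitVec ν - (N : ℤ) • q + (N : ℤ) • pshift P t = z' + (N : ℤ) • pshift P t + unitVec ν := by
        rw [hz']; abel
      rw [hgdef, ept]
      ring
    rw [efun] at H
    have lhs_eq : side Lc j * |hTor Lc j P μ q κ (z + unitVec ν) - hTor Lc j P μ q κ z|
        = side Lc j * side Lc j ^ 5 * |Hper N P μ q κ (z + unitVec ν) - Hper N P μ q κ z| := by
      rw [hT, hT, ← mul_sub, abs_mul, abs_of_pos (pow_pos hs 5)]; ring
    have rhs_eq : |∑' t : Site 4, g (z' + (N : ℤ) • pshift P t)|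
        = side Lc j * side Lc j ^ 5 * |Hper N P μ q κ (z + unitVec ν) - Hper N P μ q κ z| := by
      rw [H.tsum_eq, abs_mul, abs_of_pos (by positivity : (0 : ℝ) < side Lc j * side Lc j ^ 5)]
    rw [lhs_eq, ← rhs_eq, ← hq]
    exact hb
  · -- N²·|Δ_vec h|
    set g : Site 4 → ℝ := fun w => side Lc j ^ 2 * (side Lc j ^ 5 * lapVec (fun κ w => wH (N := N) κ μ w) ν w) with hgdef
    have hg : ∀ w, |g w| ≤ C * Real.exp (-(κ₀ * supNorm (quo N w))) := fun w => by
      have := h3 j μ ν w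
      rw [ecol, lapVec_smul] at this
      rw [hgdef, abs_mul, abs_of_pos (pow_pos hs 2), abs_mul, abs_of_pos (pow_pos hs 5)]
      rw [abs_mul, abs_of_pos (pow_pos hs 5)] at this
      exact this
    obtain ⟨_, hb⟩ := periodise_block_decay (N := N) g hκ₀ hg hP z'
    have HL : HasSum (fun t : Site 4 => lapVec (Hcol (N := N) μ (q - pshift P t)) ν z) (lapVec (Hper N P μ q) ν z) :=
      hasSum_lapVec (fun κ' x' => hasSum_Hper N P μ q κ' x') ν z
    have efun : (fun t : Site 4 => side Lc j ^ 2 * (side Lc j ^ 5 * lapVec (Hcol (N := N) μ (q - pshift P t)) ν z))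
        = fun t => g (z' + (N : ℤ) • pshift P t) := by
      funext t
      have et : lapVec (Hcol (N := N) μ (q - pshift P t)) ν z = lapVec (fun κ w => wH (N := N) κ μ w) ν (z' + (N : ℤ) • pshift P t) := by
        rw [← sub_zsmul_sub_pshift (N := N) P q t z]
        exact lapVec_translate (fun κ w => wH (N := N) κ μ w) ((N : ℤ) • (q - pshift P t)) ν z
      rw [hgdef, et]
    have H := (HL.mul_left (side Lc j ^ 5)).mul_left (side Lc j ^ 2)
    rw [efun] at H
    have lhs_eq : side Lc j ^ 2 * |lapVec (hTor Lc j P μ q) ν z| = side Lc j ^ 2 * (side Lc j ^ 5 * |lapVec (Hper N P μ q) ν z|) := by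
      rw [hTf, lapVec_smul, abs_mul, abs_of_pos (pow_pos hs 5)]
    have rhs_eq : |∑' t : Site 4, g (z' + (N : ℤ) • pshift P t)| = side Lc j ^ 2 * (side Lc j ^ 5 * |lapVec (Hper N P μ q) ν z|) := by
      rw [H.tsum_eq, abs_mul, abs_of_pos (pow_pos hs 2), abs_mul, abs_of_pos (pow_pos hs 5)]
    rw [lhs_eq, ← rhs_eq, ← hq]
    exact hb
  · -- N²·|d d* h|
    set g : Site 4 → ℝ := fun w => side Lc j ^ 2 * (side Lc j ^ 5 * dz (codiff₁ (fun κ w => wH (N := N) κ μ w)) ν w) with hgdef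
    have hg : ∀ w, |g w| ≤ C * Real.exp (-(κ₀ * supNorm (quo N w))) := fun w => by
      have := h4 j μ ν w
      rw [ecol, dz_codiff₁_smul] at this
      rw [hgdef, abs_mul, abs_of_pos (pow_pos hs 2), abs_mul, abs_of_pos (pow_pos hs 5)]
      rw [abs_mul, abs_of_pos (pow_pos hs 5)] at this
      exact this
    obtain ⟨_, hb⟩ := periodise_block_decay (N := N) g hκ₀ hg hP z'
    have HL : HasSum (fun t : Site 4 => dz (codiff₁ (Hcol (N := N) μ (q - pshift P t))) ν z) (dz (codiff₁ (Hper N P μ q)) ν z) :=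
      hasSum_dz (fun x' => hasSum_codiff₁ (fun κ' x'' => hasSum_Hper N P μ q κ' x'') x') ν z
    have efun : (fun t : Site 4 => side Lc j ^ 2 * (side Lc j ^ 5 * dz (codiff₁ (Hcol (N := N) μ (q - pshift P t))) ν z))
        = fun t => g (z' + (N : ℤ) • pshift P t) := by
      funext t
      have et : dz (codiff₁ (Hcol (N := N) μ (q - pshift P t))) ν z
          = dz (codiff₁ (fun κ w => wH (N := N) κ μ w)) ν (z' + (N : ℤ) • pshift P t) := by
        rw [← sub_zsmul_sub_pshift (N := N) P q t z]
        exact dz_codiff₁_translate (fun κ w => wH (N := N) κ μ w) ((N : ℤ) • (q - pshift P t)) ν z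
      rw [hgdef, et]
    have H := (HL.mul_left (side Lc j ^ 5)).mul_left (side Lc j ^ 2)
    rw [efun] at H
    have lhs_eq : side Lc j ^ 2 * |dz (codiff₁ (hTor Lc j P μ q)) ν z| = side Lc j ^ 2 * (side Lc j ^ 5 * |dz (codiff₁ (Hper N P μ q)) ν z|) := by
      rw [hTf, dz_codiff₁_smul, abs_mul, abs_of_pos (pow_pos hs 5)]
    have rhs_eq : |∑' t : Site 4, g (z' + (N : ℤ) • pshift P t)| = side Lc j ^ 2 * (side Lc j ^ 5 * |dz (codiff₁ (Hper N P μ q)) ν z|) := by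
      rw [H.tsum_eq, abs_mul, abs_of_pos (pow_pos hs 2), abs_mul, abs_of_pos (pow_pos hs 5)]
    rw [lhs_eq, ← rhs_eq, ← hq]
    exact hb

end Summit.QuantumFields.BalabanUV.Beta.RemainderExplicitTorusBounds

end
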